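import Summits.HodgeConjecture.CorCM.HypLiu418.A3Liu418EpsRigidFaceTypes
import Literature.NumberTheory.Automorphic.Liu2021.Def411WeilCarriersGaloisTwistOmega
import Literature.NumberTheory.GelbartRogawski1991.LocalSplittingCMGaloisTransportUndoubled
import HarnessLib

/-!
# Line `a3-liu418`, row III-11a `LocalTypeGaloisTwist`: the ASSEMBLY modulo one transport identity (harness of record)

Summits side, binder subdirectory `CorCM/HypLiu418/` (cell `hodgecm-mathlib`, fan A, rung A-III; crux item stmt-HodgeConjecture-24832; row III-11a of the
inventory, closer B-p08 per director g2 BATCH 64).  THEOREMS ONLY (proof lane), nothing new asserted: this file reduces the face Prop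
`LocalTypeGaloisTwist` (✔ `A3Liu418EpsRigidFaceTypes.lean`, A-p19) to ONE transport identity in the currency of the family of record `famAtV`
(`Summit.HodgeConjecture.CorCM.Lines.A4LiuD3.famAtV`):

**`localTypeGaloisTwist_of_transport (hT) : LocalTypeGaloisTwist`**, where `hT` says: for the face data and members `i₀ i₁` (same `μ`, `σ` fixing `M_μ`,
`σ ∘ ψ_v = ψ_v(κ·)`, `s² · (a_{i₁}/a_{i₀}) = κ`, `χ_{i₁} = σ ∘ χ_{i₀}`) there is a `ℂ`-linear automorphism `D` of `𝒮(F⁺_v³)` with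
`D (ω_κ(galTwist_σ (s_{i₀}(g ⊗ 1))) f) = ω_{s_{i₁}}(g ⊗ 1) (D f)` for all `g ∈ U(J_V)(F⁺_v)`, `f` — the Galois-twisted μ-normalised Weil package of
member `i₀` (✔ `LocalMp.galTwist`, B-p08 p610903, at the shifted character `ψ_v(κ·)`) is carried by `D` onto the package of member `i₁`.  In the road
this `D` is the dilation `D_s` (✔ `SchrodingerAddCharDilation`, B-p14 p610425; `LocalMpAddCharRescaling`, B-p14 §3) and the identity is the
`σ`-stability of the μ-normalised splitting (B-p13 P3b, ✔ `LocalParabolicScalarGaloisFixed` p611656 + main); when those land,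
`localTypeGaloisTwist_holds := localTypeGaloisTwist_of_transport (their theorem)` is a one-liner appended here.
The proof is ✔ `Def411WeilCarriers.exists_semilinear_quot_of_galTwist_transport` (B-p08, layer B: the intertwiner `D ∘ (f ↦ σ ∘ f)` is
`σ`-semilinear, bijective and intertwines `ω_{i₀}` with `ω_{i₁}`; layer A: it descends to the Step-3 quotients because `χ_{i₁,v} ∘ θ = σ ∘ (χ_{i₀,v} ∘ θ)`,
✔ `localCharOfCenter_theta_eq`, and ✔ `CentralCharacterQuotient.exists_semilinear_quotRep_of_bijective`, B-p03 p611777) instantiated at the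
`famAtV` parameters (`F⁺ ⊂ F`, `c`, `δ = imagUnit F`, `T_V = realDiagonal dV`, `e₁`, `𝓢_t = chiLocalSplittingsD … μ_t … a_t`).

HC_CM is proved only modulo the 7 printed citations (`hDel`, `h21`, `hLiu418`, `h411`, `h413`, `hD3`, `hD1''`) until rung 0 closes; this file discharges none
of them (row III-11a stays open until `hT` is a theorem).

## References
* [Liu2021] Y. Liu, Camb. J. Math. 9 (2021) = arXiv:2102.11518, Thm. 4.18 (3) with proof l. 2272–2289; Def. 4.11–4.12; App. D §D.1.
* [MoeglinVignerasWaldspurger1987] C. Mœglin, M.-F. Vignéras, J.-L. Waldspurger, LNM 1291, Chap. 2 II.1 and Remarque (2).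
-/

set_option autoImplicit false

noncomputable section

namespace Summit.HodgeConjecture.CorCM.Lines.A3Liu418

open scoped TensorProduct Matrix
open NumberField NumberField.InfinitePlace
open Literature.NumberTheory.ComplexMultiplication
open Literature.NumberTheory.Automorphic
open Literature.NumberTheory.Automorphic.IdeleClassGroup (toHeckeCharacter isUnitary_toHeckeCharacter)
open Literature.NumberTheory.Automorphic.Liu2021
open Literature.NumberTheory.Automorphic.Liu2021.Def411WeilCarriers (TW JW localIndexedFamilyAtV
  transpose_map_conj_JV det_JV_ne_zero exists_semilinear_quot_of_galTwist_transport)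
open HodgeCM.Model.ArchSideTerm (e₁)
open Literature.NumberTheory.GelbartRogawski1991 Literature.NumberTheory.GelbartRogawski1991.UnitaryDualPair
open Literature.NumberTheory.GelbartRogawski1991.UnitaryDualPair.LocalSplitting
open Literature.RepresentationTheory Literature.RepresentationTheory.Liu2021 Literature.RepresentationTheory.HeisenbergGroup
open Summit.HodgeConjecture.CorCM.Lines.A4LiuD3 (famAtV)
open Summit.HodgeConjecture.CorCM.Transposition

-- long ∀-binder hypothesis mirroring `LocalTypeGaloisTwist`: about 4× the default elaboration budget
set_option maxHeartbeats 3200000 in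
/-- **ROW III-11a MODULO THE TRANSPORT IDENTITY.**  If, for every face datum and members `i₀ i₁` as in `LocalTypeGaloisTwist`, some `ℂ`-linear
automorphism `D` of `𝒮(F⁺_v³)` carries the `σ`-twisted package of member `i₀` (at the shifted character `ψ_v(κ·)`) onto the package of member `i₁`
along `U(J_V)(F⁺_v)` — `D (ω_κ(galTwist_σ(s_{i₀}(g ⊗ 1))) f) = ω_{s_{i₁}}(g ⊗ 1) (D f)` — then `LocalTypeGaloisTwist` holds: the bijective
`σ`-semilinear `U(J_V)(F⁺_v)`-map of Step-3 quotients is induced by `D ∘ (f ↦ σ ∘ f)`.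
[cite: Liu2021, Thm. 4.18 (3) with proof l. 2272–2289] [cite: MoeglinVignerasWaldspurger1987, Chap. 2 II.1 and Remarque (2)] -/
theorem localTypeGaloisTwist_of_transport
    (hT : ∀ (F : HodgeCM.CMField) (dV : Fin 3 → (F : Type))
      (hdV : ∀ i, IsCMField.complexConj (F : Type) (dV i) = dV i) (hdV0 : ∀ i, dV i ≠ 0) {ι : Type}
      (ψ : ι → (Literature.NumberTheory.Automorphic.IdeleClassGroup (F : Type) →ₜ* Circle))
      (hψ : ∀ t, IdeleClassGroup.IsConjugateSymplectic (F : Type) (ψ t))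
      (aOf : ι → (↥(maximalRealSubfield (F : Type)))ˣ)
      (χOf : ι → Def411WeilCarriers.Chi ↥(maximalRealSubfield (F : Type)) (F : Type) (IsCMField.complexConj (F : Type)))
      (v : IsDedekindDomain.HeightOneSpectrum (𝓞 ↥(maximalRealSubfield (F : Type)))),
      IsField (UnitaryGroup.LocalRing (F : Type) v) →
      ∀ (i₀ i₁ : ι), ψ i₁ = ψ i₀ →
      ∀ (σ : ℂ ≃+* ℂ), (∀ z : ℂ, z ∈ Liu2021.fieldOfValues (F : Type) (ψ i₀) → σ z = z) →
      ∀ (κ : v.adicCompletion ↥(maximalRealSubfield (F : Type)))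
        (hκ : ∀ r : v.adicCompletion ↥(maximalRealSubfield (F : Type)),
            σ ((adeleAddCharAt ↥(maximalRealSubfield (F : Type)) v r : Circle) : ℂ) =
              ((adeleAddCharAt ↥(maximalRealSubfield (F : Type)) v (κ * r) : Circle) : ℂ)),
      ∀ (s : (v.adicCompletion ↥(maximalRealSubfield (F : Type)))ˣ),
        (s : v.adicCompletion ↥(maximalRealSubfield (F : Type))) * s *
            algebraMap ↥(maximalRealSubfield (F : Type)) (v.adicCompletion ↥(maximalRealSubfield (F : Type)))
              (((aOf i₁ : (↥(maximalRealSubfield (F : Type)))ˣ) : ↥(maximalRealSubfield (F : Type))) *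
                ((aOf i₀ : (↥(maximalRealSubfield (F : Type)))ˣ) : ↥(maximalRealSubfield (F : Type)))⁻¹) = κ →
        (∀ u, ((((χOf i₁).1 u : ℂˣ)) : ℂ) = σ (((χOf i₀).1 u : ℂˣ) : ℂ)) →
        ∃ D : SchwartzBruhat (Fin 3 → v.adicCompletion ↥(maximalRealSubfield (F : Type))) ≃ₗ[ℂ]
            SchwartzBruhat (Fin 3 → v.adicCompletion ↥(maximalRealSubfield (F : Type))),
          ∀ (g : (famAtV F e₁ dV hdV hdV0 ψ hψ aOf χOf v).S.U)
            (f : SchwartzBruhat (Fin 3 → v.adicCompletion ↥(maximalRealSubfield (F : Type)))),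
            D (MpPsi.toRep (localSchrodingerMulShift ↥(maximalRealSubfield (F : Type)) 3
                  (gram ↥(maximalRealSubfield (F : Type)) e₁ (realDiagonal (F : Type) dV hdV) (TW ↥(maximalRealSubfield (F : Type)) (aOf i₀))) v κ)
                (LocalMp.galTwist ↥(maximalRealSubfield (F : Type)) 3
                  (gram ↥(maximalRealSubfield (F : Type)) e₁ (realDiagonal (F : Type) dV hdV) (TW ↥(maximalRealSubfield (F : Type)) (aOf i₀))) v
                  (σ : ℂ →+* ℂ) (σ.symm : ℂ →+* ℂ) σ.apply_symm_apply σ.symm_apply_apply κ hκ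
                  ((OmegaChiSplitting.chiLocalSplittingsD ⟨HodgeCM.CMField.K F⟩ e₁ dV hdV hdV0 (toHeckeCharacter (F : Type) (ψ i₀))
                      ((isOscillatorChar_toHeckeCharacter_iff (ψ i₀)).mpr (hψ i₀)) (aOf i₀)).s v
                    (UnitaryGroup.localLineInl (F : Type) (IsCMField.complexConj (F : Type)) 3 e₁ (Matrix.diagonal dV)
                      (JW ↥(maximalRealSubfield (F : Type)) (F : Type) (aOf i₀)) v
                      (LemD1OfPlace.uEquiv (F : Type) v (IsCMField.complexConj (F : Type)) 3 (Matrix.diagonal dV)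
                        (complexConj_imagUnit (F : Type)) (imagUnit_ne_zero (F : Type))
                        (famAtV F e₁ dV hdV hdV0 ψ hψ aOf χOf v).S.two_le
                        (transpose_map_conj_JV ↥(maximalRealSubfield (F : Type)) (F : Type) (IsCMField.complexConj (F : Type)) 3
                          (Matrix.diagonal dV) (realDiagonal_isSymm (F : Type) dV hdV) (realDiagonal_map (F : Type) dV hdV).symm)
                        (det_JV_ne_zero ↥(maximalRealSubfield (F : Type)) (F : Type) 3 (Matrix.diagonal dV)
                          (isUnit_det_realDiagonal (F : Type) dV hdV hdV0) (realDiagonal_map (F : Type) dV hdV).symm) g)))) f) =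
              MpPsi.toRep (localSchrodinger ↥(maximalRealSubfield (F : Type)) 3
                  (gram ↥(maximalRealSubfield (F : Type)) e₁ (realDiagonal (F : Type) dV hdV) (TW ↥(maximalRealSubfield (F : Type)) (aOf i₁))) v)
                ((OmegaChiSplitting.chiLocalSplittingsD ⟨HodgeCM.CMField.K F⟩ e₁ dV hdV hdV0 (toHeckeCharacter (F : Type) (ψ i₁))
                    ((isOscillatorChar_toHeckeCharacter_iff (ψ i₁)).mpr (hψ i₁)) (aOf i₁)).s v
                  (UnitaryGroup.localLineInl (F : Type) (IsCMField.complexConj (F : Type)) 3 e₁ (Matrix.diagonal dV)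
                    (JW ↥(maximalRealSubfield (F : Type)) (F : Type) (aOf i₁)) v
                    (LemD1OfPlace.uEquiv (F : Type) v (IsCMField.complexConj (F : Type)) 3 (Matrix.diagonal dV)
                      (complexConj_imagUnit (F : Type)) (imagUnit_ne_zero (F : Type))
                      (famAtV F e₁ dV hdV hdV0 ψ hψ aOf χOf v).S.two_le
                      (transpose_map_conj_JV ↥(maximalRealSubfield (F : Type)) (F : Type) (IsCMField.complexConj (F : Type)) 3
                        (Matrix.diagonal dV) (realDiagonal_isSymm (F : Type) dV hdV) (realDiagonal_map (F : Type) dV hdV).symm)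
                      (det_JV_ne_zero ↥(maximalRealSubfield (F : Type)) (F : Type) 3 (Matrix.diagonal dV)
                        (isUnit_det_realDiagonal (F : Type) dV hdV hdV0) (realDiagonal_map (F : Type) dV hdV).symm) g)))
                (D f)) :
    LocalTypeGaloisTwist := by
  intro F dV hdV hdV0 ι ψ hψ aOf χOf v hE i₀ i₁ hψ₁ σ hσ κ hκ s hs hχ
  obtain ⟨D, hD⟩ := hT F dV hdV hdV0 ψ hψ aOf χOf v hE i₀ i₁ hψ₁ σ hσ κ hκ s hs hχ
  exact exists_semilinear_quot_of_galTwist_transport ↥(maximalRealSubfield (F : Type)) (F : Type) (IsCMField.complexConj (F : Type)) 3 e₁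
    (Matrix.diagonal dV) (complexConj_imagUnit (F : Type)) (imagUnit_ne_zero (F : Type)) (imagUnit_mul_self (F : Type))
    (realDiagonal_isSymm (F : Type) dV hdV) (isUnit_det_realDiagonal (F : Type) dV hdV hdV0) (realDiagonal_map (F : Type) dV hdV).symm
    (le_refl 3) aOf χOf
    (fun t => OmegaChiSplitting.chiLocalSplittingsD ⟨HodgeCM.CMField.K F⟩ e₁ dV hdV hdV0 (toHeckeCharacter (F : Type) (ψ t))
      ((isOscillatorChar_toHeckeCharacter_iff (ψ t)).mpr (hψ t)) (aOf t))
    (fun t => localMu (F : Type) (toHeckeCharacter (F : Type) (ψ t)))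
    (fun t v x => norm_localMu (F : Type) (toHeckeCharacter (F : Type) (ψ t)) v (isUnitary_toHeckeCharacter (F : Type) (ψ t)) x)
    (fun t => continuous_localMu (F : Type) (toHeckeCharacter (F : Type) (ψ t)))
    (fun t v x => localMu_toLocalRing_eq_one_iff (F : Type) (toHeckeCharacter (F : Type) (ψ t)) v
      ((isOscillatorChar_toHeckeCharacter_iff (ψ t)).mpr (hψ t)) x)
    v i₀ i₁ (σ : ℂ →+* ℂ) (σ.symm : ℂ →+* ℂ) σ.apply_symm_apply σ.symm_apply_apply hχ κ hκ D hD


/-- bookkeeping: the `χ`-attached local splittings depend on the Hecke character only through its value — equal characters give the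
same tree term (used to read member `i₁`'s splitting at `μ_{i₀}` when `ψ i₁ = ψ i₀`). [cite: Liu2021, App. D §D.1 Step 2 (l. 5219)] -/
theorem chiLocalSplittingsD_congr_char (F : HodgeCM.CMField) (dV : Fin 3 → (F : Type))
    (hdV : ∀ i, IsCMField.complexConj (F : Type) (dV i) = dV i) (hdV0 : ∀ i, dV i ≠ 0)
    {χ χ' : Literature.NumberTheory.GaloisRepresentations.HeckeCharacter (F : Type)} (h : χ = χ')
    (hχ : Literature.RepresentationTheory.HarrisKudlaSweet1996.IsSplittingChar (F : Type) 1 χ)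
    (hχ' : Literature.RepresentationTheory.HarrisKudlaSweet1996.IsSplittingChar (F : Type) 1 χ')
    (a : (↥(maximalRealSubfield (F : Type)))ˣ) :
    OmegaChiSplitting.chiLocalSplittingsD ⟨HodgeCM.CMField.K F⟩ e₁ dV hdV hdV0 χ hχ a =
      OmegaChiSplitting.chiLocalSplittingsD ⟨HodgeCM.CMField.K F⟩ e₁ dV hdV hdV0 χ' hχ' a := by
  subst h
  rfl

-- long ∀-binder hypotheses mirroring `LocalTypeGaloisTwist`
set_option maxHeartbeats 3200000 in
/-- **ROW III-11a MODULO THE SECTION-TRANSPORT IDENTITY (operator form).**  If, for one conjugate-symplectic `ψ` (`μ = toHeckeCharacter ψ`),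
two lines `a₀, a₁`, `σ` fixing `M_μ`, `σ ∘ ψ_v = ψ_v(κ·)` and a unit `s` of `F⁺_v` with `s·s·(a₁/a₀) = κ`, the operator
`B = D_s ∘ (f ↦ σ ∘ f)` (`D_s = leviEquivSB (smulOfUnit s)`) intertwines the Weil operators of the `χ_μ`-attached splittings on the two lines along
`U(J_V)(F⁺_v)` — `B (ω(s_{a₀}(k ⊗ 1)) f) = ω(s_{a₁}(k ⊗ 1)) (B f)` (hypothesis `hβ`: the undoubling, through ✔ `apply_toRep_undoubleLoc_eq_of_box_transport`
(B-p03), of the doubled Galois-transport identity ✔ `exists_galTwist_rescale_comp_localSplittingDatumCM_eq` (B-p13) — B-p02's corollary) — then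
`LocalTypeGaloisTwist` holds: `hT` of `localTypeGaloisTwist_of_transport` with `D := D_s`, by `ω_κ(galTwist_σ y)(σ ∘ f) = σ ∘ (ω(y) f)`
(✔ `LocalMp.toRep_galTwist_schwartzGalConj`) and the surjectivity of `f ↦ σ ∘ f`, after reading member `i₁` at `μ_{i₀}` (`ψ i₁ = ψ i₀`).
[cite: Liu2021, Thm. 4.18 (3) with proof l. 2272–2289] [cite: MoeglinVignerasWaldspurger1987, Chap. 2 II.1 and Remarque (2)] -/
theorem localTypeGaloisTwist_of_sectionTransport
    (hβ : ∀ (F : HodgeCM.CMField) (dV : Fin 3 → (F : Type))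
      (hdV : ∀ i, IsCMField.complexConj (F : Type) (dV i) = dV i) (hdV0 : ∀ i, dV i ≠ 0)
      (ψ : Literature.NumberTheory.Automorphic.IdeleClassGroup (F : Type) →ₜ* Circle)
      (hψ : IdeleClassGroup.IsConjugateSymplectic (F : Type) ψ)
      (a₀ a₁ : (↥(maximalRealSubfield (F : Type)))ˣ)
      (v : IsDedekindDomain.HeightOneSpectrum (𝓞 ↥(maximalRealSubfield (F : Type))))
      (σ : ℂ ≃+* ℂ), (∀ z : ℂ, z ∈ Liu2021.fieldOfValues (F : Type) ψ → σ z = z) →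
      ∀ (κ : v.adicCompletion ↥(maximalRealSubfield (F : Type))),
        (∀ r : v.adicCompletion ↥(maximalRealSubfield (F : Type)),
            σ ((adeleAddCharAt ↥(maximalRealSubfield (F : Type)) v r : Circle) : ℂ) =
              ((adeleAddCharAt ↥(maximalRealSubfield (F : Type)) v (κ * r) : Circle) : ℂ)) →
      ∀ (s : (v.adicCompletion ↥(maximalRealSubfield (F : Type)))ˣ),
        (s : v.adicCompletion ↥(maximalRealSubfield (F : Type))) * s *
            algebraMap ↥(maximalRealSubfield (F : Type)) (v.adicCompletion ↥(maximalRealSubfield (F : Type)))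
              ((a₁ : ↥(maximalRealSubfield (F : Type))) * (a₀ : ↥(maximalRealSubfield (F : Type)))⁻¹) = κ →
      ∀ (k : UnitaryGroup.localPi (F : Type) (IsCMField.complexConj (F : Type)) 3 (Matrix.diagonal dV) v)
        (f : SchwartzBruhat (Fin 3 → v.adicCompletion ↥(maximalRealSubfield (F : Type)))),
        leviEquivSB (LinearEquiv.smulOfUnit s) (continuous_const_smul (s : v.adicCompletion ↥(maximalRealSubfield (F : Type))))
            (continuous_const_smul ((s⁻¹ : (v.adicCompletion ↥(maximalRealSubfield (F : Type)))ˣ) :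
              v.adicCompletion ↥(maximalRealSubfield (F : Type))))
          (schwartzGalConj (σ : ℂ →+* ℂ)
            (MpPsi.toRep (localSchrodinger ↥(maximalRealSubfield (F : Type)) 3
                (gram ↥(maximalRealSubfield (F : Type)) e₁ (realDiagonal (F : Type) dV hdV) (TW ↥(maximalRealSubfield (F : Type)) a₀)) v)
              ((OmegaChiSplitting.chiLocalSplittingsD ⟨HodgeCM.CMField.K F⟩ e₁ dV hdV hdV0 (toHeckeCharacter (F : Type) ψ)
                  ((isOscillatorChar_toHeckeCharacter_iff ψ).mpr hψ) a₀).s v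
                (UnitaryGroup.localLineInl (F : Type) (IsCMField.complexConj (F : Type)) 3 e₁ (Matrix.diagonal dV)
                  (JW ↥(maximalRealSubfield (F : Type)) (F : Type) a₀) v k)) f)) =
          MpPsi.toRep (localSchrodinger ↥(maximalRealSubfield (F : Type)) 3
              (gram ↥(maximalRealSubfield (F : Type)) e₁ (realDiagonal (F : Type) dV hdV) (TW ↥(maximalRealSubfield (F : Type)) a₁)) v)
            ((OmegaChiSplitting.chiLocalSplittingsD ⟨HodgeCM.CMField.K F⟩ e₁ dV hdV hdV0 (toHeckeCharacter (F : Type) ψ)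
                ((isOscillatorChar_toHeckeCharacter_iff ψ).mpr hψ) a₁).s v
              (UnitaryGroup.localLineInl (F : Type) (IsCMField.complexConj (F : Type)) 3 e₁ (Matrix.diagonal dV)
                (JW ↥(maximalRealSubfield (F : Type)) (F : Type) a₁) v k))
            (leviEquivSB (LinearEquiv.smulOfUnit s) (continuous_const_smul (s : v.adicCompletion ↥(maximalRealSubfield (F : Type))))
              (continuous_const_smul ((s⁻¹ : (v.adicCompletion ↥(maximalRealSubfield (F : Type)))ˣ) :
                v.adicCompletion ↥(maximalRealSubfield (F : Type)))) (schwartzGalConj (σ : ℂ →+* ℂ) f))) :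
    LocalTypeGaloisTwist := by
  refine localTypeGaloisTwist_of_transport fun F dV hdV hdV0 {ι} ψ hψ aOf χOf v _hE i₀ i₁ hψ₁ σ hσ κ hκ s hs _hχ => ?_
  refine ⟨leviEquivSB (LinearEquiv.smulOfUnit s) (continuous_const_smul (s : v.adicCompletion ↥(maximalRealSubfield (F : Type))))
    (continuous_const_smul ((s⁻¹ : (v.adicCompletion ↥(maximalRealSubfield (F : Type)))ˣ) :
      v.adicCompletion ↥(maximalRealSubfield (F : Type)))), fun g f => ?_⟩
  have hμ : toHeckeCharacter (F : Type) (ψ i₁) = toHeckeCharacter (F : Type) (ψ i₀) := by rw [hψ₁]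
  rw [chiLocalSplittingsD_congr_char F dV hdV hdV0 hμ ((isOscillatorChar_toHeckeCharacter_iff (ψ i₁)).mpr (hψ i₁))
    ((isOscillatorChar_toHeckeCharacter_iff (ψ i₀)).mpr (hψ i₀)) (aOf i₁)]
  obtain ⟨f', rfl⟩ := (schwartzGalConj_bijective (X := Fin 3 → v.adicCompletion ↥(maximalRealSubfield (F : Type)))
    (σ : ℂ →+* ℂ) (σ.symm : ℂ →+* ℂ) σ.apply_symm_apply).2 f
  rw [LocalMp.toRep_galTwist_schwartzGalConj]
  exact hβ F dV hdV hdV0 (ψ i₀) (hψ i₀) (aOf i₀) (aOf i₁) v σ hσ κ hκ s hs _ f'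


-- the instantiation unfolds `chiLocalSplittingsD` (delta) against the undoubled CM packages spelled in full
set_option maxHeartbeats 3200000 in
/-- **ROW III-11a CLOSED — `LocalTypeGaloisTwist` HOLDS.**  [Liu2021, Thm. 4.18 (3), proof l. 2272–2289]: for a face datum, a non-split
place `v`, members `i₀, i₁` with the same `μ`, `σ ∈ Aut(ℂ/M_μ)` with `σ ∘ ψ_v = ψ_v(κ·)`, `s² (a_{i₁}/a_{i₀}) = κ` and `χ_{i₁} = σ ∘ χ_{i₀}`,
the Step-3 quotients `ω(μ, ε_{i₀}, χ_{i₀})` and `ω(μ, ε_{i₁}, χ_{i₁})` are related by a bijective `σ`-semilinear `U(J_V)(F⁺_v)`-map.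
Assembly of record: `localTypeGaloisTwist_of_sectionTransport` (this file: `D := D_s`, `f ↦ σ ∘ f`, layers A/B
`Def411WeilCarriers.exists_semilinear_quot_of_galTwist_transport`) over the undoubled CM section transport
✔ `galDilation_toRep_congrW_undoubledSplittings_localLineInl` (B-p02; = Kudla rigidity at the doubled level
✔ `exists_galTwist_rescale_comp_localSplittingDatumCM_eq` (B-p13) descended through `undoubleLoc` ✔ `galDilation_toRep_undoubleLoc_eq_of_transport`
(B-p03), with the `ψ_v`-rescaling ✔ `exists_galTwist_rescale` (B-p14) and the Galois twist ✔ `LocalMp.galTwist` (B-p08)), read at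
`chiLocalSplittingsD ⟨K F⟩ e₁ … a = congrW … (undoubledSplittings … (cmFinLocalFamily …))` (delta).
HC_CM is proved only modulo the 7 printed citations until rung 0 closes; this theorem discharges row III-11a of the inventory (one of the
four binder types of `epsRigidAtFace_of_localTwist`), not a citation.
[cite: Liu2021, Thm. 4.18 (3) with proof l. 2272–2289] [cite: MoeglinVignerasWaldspurger1987, Chap. 2 II.1 and Remarque (2)]
[cite: Kudla1994, §3 Thm. 3.1] [cite: GelbartRogawski1991, §3.1 Prop. 3.1.1 p. 455 L1–3] -/
theorem localTypeGaloisTwist_holds : LocalTypeGaloisTwist :=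
  localTypeGaloisTwist_of_sectionTransport fun F dV hdV hdV0 ψ hψ a₀ a₁ v σ hσ κ hκ s hs k f =>
    galDilation_toRep_congrW_undoubledSplittings_localLineInl (F : Type) e₁ three_pos dV hdV hdV0 v ψ
      ((isOscillatorChar_toHeckeCharacter_iff ψ).mpr hψ) σ hσ κ hκ s a₀ a₁ hs k f

end Summit.HodgeConjecture.CorCM.Lines.A3Liu418

end
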